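import Literature.MathematicalPhysics.QuantumFieldTheory.ConformalBootstrap3D.SL2BlockRadialExpansion
import Literature.MathematicalPhysics.QuantumFieldTheory.ConformalBootstrap3D.RadialExistenceOfPositivity
import Literature.MathematicalPhysics.QuantumFieldTheory.ConformalBootstrap3D.BlockUniquenessLimit
import Mathlib.Tactic
import HarnessLib

/-!
# Even-sector blocks: the radial monomial array is non-negative, and the radial expansion exists on the whole square — unconditionally

For the `d = 3` blocks with EQUAL external dimensions (`a = b = 0`: the `σσσσ`, `εεεε` and `s`-channel
`σσεε` families; in the tree `hrBlock Δ ℓ`, the unique solution of the typed predicate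
`IsConformalBlock3D 0 0 Δ ℓ` at regular points, `BlockExistence`), Hogervorst–Rychkov's radial (`ρ`)
expansion [cite: HogervorstRychkov2013, §3 eqs. (3.4)–(3.6)] was so far available in the tree only

* on the small square `ρ, ρ̄ < 3 - 2√2` by absolute regrouping (`RadialConversion.hasSum_zRhoConv`: the
  `(√ρ,√ρ̄)`-monomial array of `(ρρ̄)^{-(Δ-ℓ)/2}·4^{-Δ}·G(z(ρ),z(ρ̄))` is the finite conversion `zRhoConv 0 Δ ℓ A`
  of the `z`-array `A = A^{HR}/λ_ℓ`), and
* on the WHOLE square CONDITIONALLY on `zRhoConv ≥ 0` (`RadialExistenceOfPositivity.hasSum_zRhoConv_of_nonneg`,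
  Hogervorst–Rychkov's "all terms in the series are positive, and so the series must converge" made rigorous
  by Vivanti–Pringsheim) — positivity being, in print, a consequence of unitarity
  [cite: HogervorstRychkov2013, §3 after eq. (3.5)], not of the Casimir equation.

This file REMOVES the positivity hypothesis for the even sector: by Hogervorst's `3 → 2` reduction formula
(`DimensionalReductionSpin.hrMonomialCoeff_eq_spin_redArr`, `DimensionalReduction3D.hrMonomialCoeff_eq_scalar_redArr`:
`g_{Δ,ℓ} = Σ_{a,b} c_{ab} k_{2(α+a)}(z) k_{2(α+b)}(z̄)` with `c_{ab} ≥ 0`, `α = (Δ-ℓ)/2`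
[cite: Hogervorst2016, §2 eqs. (2.24), (2.35)] [cite: PalQiaoRychkov2023, App. A.2 Thm A.5]) and the radial expansion
of the SL(2) block with NON-NEGATIVE coefficients (`SL2BlockRadialExpansion`: `k_{2h}(z(ρ)) = 4^h ρ^h Σ_N S_h(N) ρ^N`,
`S_h(N) ≥ 0` [cite: HogervorstRychkov2013, §3.1 (last display)]), the monomial array is a convergent
non-negative combination `4^{-Δ} Σ c_{ab} (4^{α+a} S_{α+a}(N)) (4^{α+b} S_{α+b}(M))` (`evenRadArr`), hence:

* (generic cores, also used AT the bound by `DimensionalReductionBound`: `HasSL2Reduction`, `HasZData`,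
  `hasSum_evenRadTerm_of_hasSum`, `evenRadArr_eq_zRhoConv_of_hasSum`, `zRhoConv_nonneg_of_hasSum`,
  `hasSum_zRhoConv_hrBlock_of_hasSum`;)
* `zRhoConv_nonneg_of_redArr` — for every site function `c ≥ 0` with `hrMonomialCoeff Δ ℓ = redArr Δ ℓ c`
  (`Δ` above the unitarity bound, `α > ¼`): `zRhoConv 0 Δ ℓ A ≥ 0` entrywise; specialisations
  `zRhoConv_nonneg_scalar` (`ℓ = 0`, all `Δ > ½`) and `zRhoConv_nonneg_spin` (`ℓ ≥ 1`, `Δ > ℓ + 1`,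
  off the accidental set).
* **`hasSum_zRhoConv_hrBlock`** (and `_scalar`, `_spin`, `IsConformalBlock3D.hasSum_zRhoConv_even`) —
  UNCONDITIONALLY, for all `0 < s, u < 1`:
  `HasSum (p ↦ zRhoConv 0 Δ ℓ A p · s^{p₁} u^{p₂}) ((su)^{-(Δ-ℓ)} 4^{-Δ} g_{Δ,ℓ}(z(s²), z(u²)))`,
  i.e. the even-sector block composed with the radial map is a convergent double power series in
  `(√ρ, √ρ̄)` with non-negative coefficients on the whole open unit square — Hogervorst–Rychkov's
  convergence statement "conformal block representations as power series in ρ will converge for |ρ| < 1"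
  [cite: HogervorstRychkov2013, §3 after eq. (3.5)] for these blocks, as a theorem about the Casimir
  solutions (no unitarity input).

What is NOT here (say so when quoting): positivity of the LEGENDRE-basis table `B_{n,j}`
(`HasRadialExpansion` with `w ≥ 0`, Hogervorst–Rychkov eq. (3.5)) does not follow — a non-negative
combination of `r^E cos(jθ)` need not be a non-negative combination of `r^E P_j(η)` — and stays a
hypothesis (unitarity) wherever a radial-frame rule uses it; the odd sector (`a = ±b ≠ 0`, `⟨σεσε⟩`,
`⟨εσσε⟩`) is untouched (no reduction formula in print); the unitarity bound `Δ = ℓ + 1` (`ℓ ≥ 1`) and the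
accidental points are excluded exactly as in `DimensionalReductionSpin`.

pub-ising3d RECIPE R18(ii) (AXIOMS-SOURCES S19.7). No named fact; all statements are theorems.
-/

namespace Literature.MathematicalPhysics.QuantumFieldTheory.ConformalBootstrap3D

open Finset Set

/-! ### §1. The radial family of an even-sector block and its coefficient array -/

/-- Index `((a,b),(N,M))`: lattice site `(a,b)` of the reduction formula and radial orders `N, M` of the
two SL(2) factors. [folklore] -/
abbrev EvenRadIndex := (ℕ × ℕ) × (ℕ × ℕ)

/-- The coefficient `4^{-Δ}·c_{ab}·(4^{α+a} S_{α+a}(N))·(4^{α+b} S_{α+b}(M))` of `s^{2(a+N)} u^{2(b+M)}`.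
[cite: Hogervorst2016, §2 eqs. (2.24), (2.35)] [cite: HogervorstRychkov2013, §3.1 (last display)] -/
noncomputable def evenRadCoeff (Δ : ℝ) (ℓ : ℕ) (c : ℕ → ℕ → ℝ) (r : EvenRadIndex) : ℝ :=
  (4 : ℝ) ^ (-Δ) * c r.1.1 r.1.2 *
    ((4 : ℝ) ^ (halfTwist Δ ℓ + r.1.1) * sl2RhoSum (halfTwist Δ ℓ + r.1.1) r.2.1) *
    ((4 : ℝ) ^ (halfTwist Δ ℓ + r.1.2) * sl2RhoSum (halfTwist Δ ℓ + r.1.2) r.2.2)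

/-- The `(s,u) = (√ρ,√ρ̄)`-degree `(2(a+N), 2(b+M))` of the term indexed by `((a,b),(N,M))`. [folklore] -/
def evenRadDeg (r : EvenRadIndex) : ℕ × ℕ := (2 * (r.1.1 + r.2.1), 2 * (r.1.2 + r.2.2))

/-- The term `evenRadCoeff·s^{2(a+N)} u^{2(b+M)}`. [folklore] -/
noncomputable def evenRadTerm (Δ : ℝ) (ℓ : ℕ) (c : ℕ → ℕ → ℝ) (s u : ℝ) (r : EvenRadIndex) : ℝ :=
  evenRadCoeff Δ ℓ c r * (s ^ (evenRadDeg r).1 * u ^ (evenRadDeg r).2)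

/-- **The radial monomial array of an even-sector block from the reduction formula**: the sum of the
coefficients over the (finite) fibre of `(s,u)`-degree `p`. [cite: Hogervorst2016, §2 eqs. (2.24), (2.35)] -/
noncomputable def evenRadArr (Δ : ℝ) (ℓ : ℕ) (c : ℕ → ℕ → ℝ) (p : ℕ × ℕ) : ℝ :=
  ∑' r : ↥(evenRadDeg ⁻¹' {p}), evenRadCoeff Δ ℓ c (r : EvenRadIndex)

/-- The coefficients are non-negative for `c ≥ 0` and `α > 0`. [cite: Hogervorst2016, §2.2] -/
theorem evenRadCoeff_nonneg {Δ : ℝ} {ℓ : ℕ} (hα : 0 < halfTwist Δ ℓ) {c : ℕ → ℕ → ℝ}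
    (hc : ∀ a b, 0 ≤ c a b) (r : EvenRadIndex) : 0 ≤ evenRadCoeff Δ ℓ c r := by
  unfold evenRadCoeff
  have h1 : 0 ≤ sl2RhoSum (halfTwist Δ ℓ + r.1.1) r.2.1 := sl2RhoSum_nonneg (by positivity) _
  have h2 : 0 ≤ sl2RhoSum (halfTwist Δ ℓ + r.1.2) r.2.2 := sl2RhoSum_nonneg (by positivity) _
  have h3 := hc r.1.1 r.1.2
  have h4 : 0 ≤ (4 : ℝ) ^ (-Δ) := Real.rpow_nonneg (by norm_num) _
  have h5 : 0 ≤ (4 : ℝ) ^ (halfTwist Δ ℓ + r.1.1) := Real.rpow_nonneg (by norm_num) _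
  have h6 : 0 ≤ (4 : ℝ) ^ (halfTwist Δ ℓ + r.1.2) := Real.rpow_nonneg (by norm_num) _
  have h7 : 0 ≤ (4 : ℝ) ^ (halfTwist Δ ℓ + r.1.1) * sl2RhoSum (halfTwist Δ ℓ + r.1.1) r.2.1 :=
    mul_nonneg h5 h1
  have h8 : 0 ≤ (4 : ℝ) ^ (halfTwist Δ ℓ + r.1.2) * sl2RhoSum (halfTwist Δ ℓ + r.1.2) r.2.2 :=
    mul_nonneg h6 h2
  exact mul_nonneg (mul_nonneg (mul_nonneg h4 h3) h7) h8

/-- **Non-negativity of the radial monomial array** (`c ≥ 0`, `α > 0`). [cite: Hogervorst2016, §2.2] -/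
theorem evenRadArr_nonneg {Δ : ℝ} {ℓ : ℕ} (hα : 0 < halfTwist Δ ℓ) {c : ℕ → ℕ → ℝ}
    (hc : ∀ a b, 0 ≤ c a b) (p : ℕ × ℕ) : 0 ≤ evenRadArr Δ ℓ c p :=
  tsum_nonneg fun _ => evenRadCoeff_nonneg hα hc _

/-! ### §2. The radial family sums to the block on the small square -/

/-- `4s²/(1-s²)² < 1` for `0 < s < √2 - 1`. [folklore] -/
theorem four_sq_div_lt_one {s : ℝ} (hs0 : 0 < s) (hs1 : s < Real.sqrt 2 - 1) :
    4 * s ^ 2 / (1 - s ^ 2) ^ 2 < 1 := by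
  have hs1' : s < 1 := hs1.trans sqrt_two_sub_one_lt_one
  have h1 : 0 < 1 - s ^ 2 := by nlinarith
  have h := two_mul_div_one_sub_sq_lt_one hs0 hs1
  have h0 : 0 ≤ 2 * s / (1 - s ^ 2) := by positivity
  have hsq : (2 * s / (1 - s ^ 2)) ^ 2 < 1 := by nlinarith
  have heq : 4 * s ^ 2 / (1 - s ^ 2) ^ 2 = (2 * s / (1 - s ^ 2)) ^ 2 := by
    field_simp
    ring
  rw [heq]
  exact hsq

/-- `(s²)^{α+a} = s^{Δ-ℓ}·s^{2a}` (`α = (Δ-ℓ)/2`, `s > 0`). [folklore] -/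
theorem sq_rpow_halfTwist_add {Δ : ℝ} {ℓ : ℕ} {s : ℝ} (hs : 0 < s) (a : ℕ) :
    (s ^ 2) ^ (halfTwist Δ ℓ + (a : ℝ)) = s ^ (Δ - (ℓ : ℝ)) * s ^ (2 * a) := by
  rw [Real.rpow_add_natCast (pow_pos hs 2).ne', ← Real.rpow_natCast s 2,
    ← Real.rpow_mul hs.le, Real.rpow_natCast s 2, ← pow_mul]
  unfold halfTwist
  push_cast
  ring_nf

/-- The reduction formula at the function level, as a HYPOTHESIS on `(Δ, ℓ, c)`: on the open square
`g^{HR}_{Δ,ℓ}(x,y) = Σ_{a,b} c_{ab} k_{2(α+a)}(x) k_{2(α+b)}(y)`. Discharged strictly above the unitarity bound by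
`DimensionalReductionSeries.hasSum_redArr_sl2Block`, and at the bound `Δ = ℓ + 1` by
`DimensionalReductionBound.hrBlock_hasSum_bound`. [cite: PalQiaoRychkov2023, App. A.2 Thm A.5] -/
def HasSL2Reduction (Δ : ℝ) (ℓ : ℕ) (c : ℕ → ℕ → ℝ) : Prop :=
  ∀ ⦃x y : ℝ⦄, 0 < x → x < 1 → 0 < y → y < 1 →
    HasSum (fun p : ℕ × ℕ => c p.1 p.2 * sl2Block (halfTwist Δ ℓ + p.1) x * sl2Block (halfTwist Δ ℓ + p.2) y)
      (hrBlock Δ ℓ x y)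

/-- Strictly above the unitarity bound the reduction hypothesis follows from the coefficient identity
`hrMonomialCoeff Δ ℓ = redArr Δ ℓ c`. [cite: PalQiaoRychkov2023, App. A.2 Thm A.5] -/
theorem hasSL2Reduction_of_redArr {Δ : ℝ} {ℓ : ℕ} (hΔ : unitarityBound3D ℓ < Δ) (hα : 1 / 4 < halfTwist Δ ℓ)
    (c : ℕ → ℕ → ℝ) (hc : ∀ a b, 0 ≤ c a b) (hred : hrMonomialCoeff Δ ℓ = redArr Δ ℓ c) :
    HasSL2Reduction Δ ℓ c :=
  fun _ _ hx0 hx1 hy0 hy1 => hasSum_redArr_sl2Block hΔ hα c hc hred hx0 hx1 hy0 hy1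

/-- **The radial family of an even-sector block sums to the block** (small square), from the reduction
hypothesis: for `c ≥ 0` with `HasSL2Reduction Δ ℓ c`, `α > ¼` and `0 < s, u < √2 - 1`,
`Σ_{a,b,N,M} evenRadTerm = (su)^{-(Δ-ℓ)} 4^{-Δ} g_{Δ,ℓ}(z(s²), z(u²))`.
[cite: Hogervorst2016, §2 eqs. (2.24), (2.35)] [cite: HogervorstRychkov2013, §3 "first method"] -/
theorem hasSum_evenRadTerm_of_hasSum {Δ : ℝ} {ℓ : ℕ} (hα : 1 / 4 < halfTwist Δ ℓ)
    (c : ℕ → ℕ → ℝ) (hc : ∀ a b, 0 ≤ c a b) (hredf : HasSL2Reduction Δ ℓ c)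
    {s u : ℝ} (hs0 : 0 < s) (hs1 : s < Real.sqrt 2 - 1) (hu0 : 0 < u) (hu1 : u < Real.sqrt 2 - 1) :
    HasSum (evenRadTerm Δ ℓ c s u)
      ((s * u) ^ (-(Δ - (ℓ : ℝ))) * (4 : ℝ) ^ (-Δ) * hrBlock Δ ℓ (zOfRho (s ^ 2)) (zOfRho (u ^ 2))) := by
  have hs1' : s < 1 := hs1.trans sqrt_two_sub_one_lt_one
  have hu1' : u < 1 := hu1.trans sqrt_two_sub_one_lt_one
  have hs2 : s ^ 2 < 1 := by nlinarith
  have hu2 : u ^ 2 < 1 := by nlinarith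
  set x := zOfRho (s ^ 2) with hx
  set y := zOfRho (u ^ 2) with hy
  have hx0 : 0 < x := zOfRho_pos (pow_pos hs0 2)
  have hy0 : 0 < y := zOfRho_pos (pow_pos hu0 2)
  have hx1 : x < 1 := zOfRho_lt_one (by nlinarith) hs2.ne
  have hy1 : y < 1 := zOfRho_lt_one (by nlinarith) hu2.ne
  have hα0 : 0 < halfTwist Δ ℓ := by linarith
  -- the reduction formula at `(x,y)` and the SL(2) radial expansions
  have hblock := hredf hx0 hx1 hy0 hy1
  have h1 : ∀ a : ℕ, HasSum (fun N : ℕ => (4 : ℝ) ^ (halfTwist Δ ℓ + a) * (s ^ 2) ^ (halfTwist Δ ℓ + a) *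
      sl2RhoSum (halfTwist Δ ℓ + a) N * (s ^ 2) ^ N) (sl2Block (halfTwist Δ ℓ + a) x) := fun a =>
    hasSum_sl2Block_zOfRho (by have := (Nat.cast_nonneg a : (0 : ℝ) ≤ a); linarith) (pow_pos hs0 2) hs2
      (four_sq_div_lt_one hs0 hs1)
  have h2 : ∀ b : ℕ, HasSum (fun M : ℕ => (4 : ℝ) ^ (halfTwist Δ ℓ + b) * (u ^ 2) ^ (halfTwist Δ ℓ + b) *
      sl2RhoSum (halfTwist Δ ℓ + b) M * (u ^ 2) ^ M) (sl2Block (halfTwist Δ ℓ + b) y) := fun b =>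
    hasSum_sl2Block_zOfRho (by have := (Nat.cast_nonneg b : (0 : ℝ) ≤ b); linarith) (pow_pos hu0 2) hu2
      (four_sq_div_lt_one hu0 hu1)
  -- the four-index non-negative family
  set Ψ : EvenRadIndex → ℝ := fun r => c r.1.1 r.1.2 *
      ((4 : ℝ) ^ (halfTwist Δ ℓ + r.1.1) * (s ^ 2) ^ (halfTwist Δ ℓ + r.1.1) *
        sl2RhoSum (halfTwist Δ ℓ + r.1.1) r.2.1 * (s ^ 2) ^ r.2.1) *
      ((4 : ℝ) ^ (halfTwist Δ ℓ + r.1.2) * (u ^ 2) ^ (halfTwist Δ ℓ + r.1.2) *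
        sl2RhoSum (halfTwist Δ ℓ + r.1.2) r.2.2 * (u ^ 2) ^ r.2.2) with hΨ
  have hT1 : ∀ a N : ℕ, 0 ≤ (4 : ℝ) ^ (halfTwist Δ ℓ + a) * (s ^ 2) ^ (halfTwist Δ ℓ + a) *
      sl2RhoSum (halfTwist Δ ℓ + a) N * (s ^ 2) ^ N := fun a N => by
    have := sl2RhoSum_nonneg (by positivity : 0 < halfTwist Δ ℓ + a) N
    have : 0 ≤ (4 : ℝ) ^ (halfTwist Δ ℓ + a) := Real.rpow_nonneg (by norm_num) _
    have : 0 ≤ (s ^ 2) ^ (halfTwist Δ ℓ + (a : ℝ)) := Real.rpow_nonneg (sq_nonneg s) _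
    positivity
  have hT2 : ∀ b M : ℕ, 0 ≤ (4 : ℝ) ^ (halfTwist Δ ℓ + b) * (u ^ 2) ^ (halfTwist Δ ℓ + b) *
      sl2RhoSum (halfTwist Δ ℓ + b) M * (u ^ 2) ^ M := fun b M => by
    have := sl2RhoSum_nonneg (by positivity : 0 < halfTwist Δ ℓ + b) M
    have : 0 ≤ (4 : ℝ) ^ (halfTwist Δ ℓ + b) := Real.rpow_nonneg (by norm_num) _
    have : 0 ≤ (u ^ 2) ^ (halfTwist Δ ℓ + (b : ℝ)) := Real.rpow_nonneg (sq_nonneg u) _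
    positivity
  have hΨnn : 0 ≤ Ψ := fun r => by
    simp only [hΨ]
    exact mul_nonneg (mul_nonneg (hc _ _) (hT1 _ _)) (hT2 _ _)
  have hfib : ∀ p : ℕ × ℕ, HasSum (fun q : ℕ × ℕ => Ψ (p, q))
      (c p.1 p.2 * sl2Block (halfTwist Δ ℓ + p.1) x * sl2Block (halfTwist Δ ℓ + p.2) y) := fun p => by
    have hfg := (h1 p.1).summable.mul_of_nonneg (h2 p.2).summable (fun N => hT1 p.1 N)
      (fun M => hT2 p.2 M)
    have h := ((h1 p.1).mul (h2 p.2) hfg).mul_left (c p.1 p.2)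
    rw [show c p.1 p.2 * sl2Block (halfTwist Δ ℓ + p.1) x * sl2Block (halfTwist Δ ℓ + p.2) y =
        c p.1 p.2 * (sl2Block (halfTwist Δ ℓ + p.1) x * sl2Block (halfTwist Δ ℓ + p.2) y) by ring]
    refine h.congr_fun fun q => ?_
    simp only [hΨ]
    ring
  have hΨsum : Summable Ψ := by
    rw [summable_prod_of_nonneg hΨnn]
    exact ⟨fun p => (hfib p).summable, hblock.summable.congr fun p => ((hfib p).tsum_eq).symm⟩
  have hΨhas : HasSum Ψ (hrBlock Δ ℓ x y) := by
    have h3 : HasSum (fun p : ℕ × ℕ => c p.1 p.2 * sl2Block (halfTwist Δ ℓ + p.1) x *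
        sl2Block (halfTwist Δ ℓ + p.2) y) (∑' r, Ψ r) := hΨsum.hasSum.prod_fiberwise hfib
    rw [← h3.unique hblock]
    exact hΨsum.hasSum
  -- normalise: multiply by `(su)^{-(Δ-ℓ)} 4^{-Δ}`
  have hsu : 0 < s * u := mul_pos hs0 hu0
  have hK : (s * u) ^ (-(Δ - (ℓ : ℝ))) * (s ^ (Δ - (ℓ : ℝ)) * u ^ (Δ - (ℓ : ℝ))) = 1 := by
    rw [← Real.mul_rpow hs0.le hu0.le, Real.rpow_neg hsu.le,
      inv_mul_cancel₀ (Real.rpow_pos_of_pos hsu _).ne']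
  have hmul := hΨhas.mul_left ((s * u) ^ (-(Δ - (ℓ : ℝ))) * (4 : ℝ) ^ (-Δ))
  rw [show (s * u) ^ (-(Δ - (ℓ : ℝ))) * (4 : ℝ) ^ (-Δ) * hrBlock Δ ℓ (zOfRho (s ^ 2)) (zOfRho (u ^ 2)) =
      (s * u) ^ (-(Δ - (ℓ : ℝ))) * (4 : ℝ) ^ (-Δ) * hrBlock Δ ℓ x y by rw [hx, hy]]
  refine hmul.congr_fun fun r => ?_
  simp only [hΨ, evenRadTerm, evenRadCoeff, evenRadDeg]
  rw [sq_rpow_halfTwist_add hs0, sq_rpow_halfTwist_add hu0, ← pow_mul, ← pow_mul]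
  linear_combination (-((4 : ℝ) ^ (-Δ) * c r.1.1 r.1.2 *
    ((4 : ℝ) ^ (halfTwist Δ ℓ + r.1.1) * sl2RhoSum (halfTwist Δ ℓ + r.1.1) r.2.1) *
    ((4 : ℝ) ^ (halfTwist Δ ℓ + r.1.2) * sl2RhoSum (halfTwist Δ ℓ + r.1.2) r.2.2) *
    (s ^ (2 * r.1.1) * s ^ (2 * r.2.1) * (u ^ (2 * r.1.2) * u ^ (2 * r.2.2))))) * hK

/-- **The radial family of an even-sector block sums to the block** (small square): for `c ≥ 0` with
`hrMonomialCoeff Δ ℓ = redArr Δ ℓ c` (strictly above the bound) and `0 < s, u < √2 - 1`,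
`Σ_{a,b,N,M} evenRadTerm = (su)^{-(Δ-ℓ)} 4^{-Δ} g_{Δ,ℓ}(z(s²), z(u²))`.
[cite: Hogervorst2016, §2 eqs. (2.24), (2.35)] [cite: HogervorstRychkov2013, §3 "first method"] -/
theorem hasSum_evenRadTerm {Δ : ℝ} {ℓ : ℕ} (hΔ : unitarityBound3D ℓ < Δ) (hα : 1 / 4 < halfTwist Δ ℓ)
    (c : ℕ → ℕ → ℝ) (hc : ∀ a b, 0 ≤ c a b) (hred : hrMonomialCoeff Δ ℓ = redArr Δ ℓ c)
    {s u : ℝ} (hs0 : 0 < s) (hs1 : s < Real.sqrt 2 - 1) (hu0 : 0 < u) (hu1 : u < Real.sqrt 2 - 1) :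
    HasSum (evenRadTerm Δ ℓ c s u)
      ((s * u) ^ (-(Δ - (ℓ : ℝ))) * (4 : ℝ) ^ (-Δ) * hrBlock Δ ℓ (zOfRho (s ^ 2)) (zOfRho (u ^ 2))) :=
  hasSum_evenRadTerm_of_hasSum hα c hc (hasSL2Reduction_of_redArr hΔ hα c hc hred) hs0 hs1 hu0 hu1

/-! ### §3. Regrouping by `(s,u)`-degree -/

/-- On the fibre of degree `p` the term is the coefficient times the fixed monomial. [folklore] -/
theorem tsum_fiber_evenRadTerm (Δ : ℝ) (ℓ : ℕ) (c : ℕ → ℕ → ℝ) (s u : ℝ) (p : ℕ × ℕ) :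
    ∑' r : ↥(evenRadDeg ⁻¹' {p}), evenRadTerm Δ ℓ c s u (r : EvenRadIndex) =
      evenRadArr Δ ℓ c p * (s ^ p.1 * u ^ p.2) := by
  unfold evenRadArr
  rw [← tsum_mul_right]
  refine tsum_congr fun r => ?_
  have hr : evenRadDeg (r : EvenRadIndex) = p := r.2
  unfold evenRadTerm
  rw [hr]

/-- The block as a non-negative double power series in `(√ρ,√ρ̄)`, small square, from the reduction
hypothesis. [cite: Hogervorst2016, §2 eqs. (2.24), (2.35)] [cite: HogervorstRychkov2013, §3 "first method"] -/
theorem hasSum_evenRadArr_of_hasSum {Δ : ℝ} {ℓ : ℕ} (hα : 1 / 4 < halfTwist Δ ℓ)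
    (c : ℕ → ℕ → ℝ) (hc : ∀ a b, 0 ≤ c a b) (hredf : HasSL2Reduction Δ ℓ c)
    {s u : ℝ} (hs0 : 0 < s) (hs1 : s < Real.sqrt 2 - 1) (hu0 : 0 < u) (hu1 : u < Real.sqrt 2 - 1) :
    HasSum (fun p : ℕ × ℕ => evenRadArr Δ ℓ c p * (s ^ p.1 * u ^ p.2))
      ((s * u) ^ (-(Δ - (ℓ : ℝ))) * (4 : ℝ) ^ (-Δ) * hrBlock Δ ℓ (zOfRho (s ^ 2)) (zOfRho (u ^ 2))) := by
  have h := (hasSum_evenRadTerm_of_hasSum hα c hc hredf hs0 hs1 hu0 hu1).tsum_fiberwise evenRadDeg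
  simpa only [tsum_fiber_evenRadTerm] using h

/-- **The block as a non-negative double power series in `(√ρ,√ρ̄)`, small square.** [cite: Hogervorst2016, §2 eqs. (2.24), (2.35)]
[cite: HogervorstRychkov2013, §3 "first method"] -/
theorem hasSum_evenRadArr {Δ : ℝ} {ℓ : ℕ} (hΔ : unitarityBound3D ℓ < Δ) (hα : 1 / 4 < halfTwist Δ ℓ)
    (c : ℕ → ℕ → ℝ) (hc : ∀ a b, 0 ≤ c a b) (hred : hrMonomialCoeff Δ ℓ = redArr Δ ℓ c)
    {s u : ℝ} (hs0 : 0 < s) (hs1 : s < Real.sqrt 2 - 1) (hu0 : 0 < u) (hu1 : u < Real.sqrt 2 - 1) :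
    HasSum (fun p : ℕ × ℕ => evenRadArr Δ ℓ c p * (s ^ p.1 * u ^ p.2))
      ((s * u) ^ (-(Δ - (ℓ : ℝ))) * (4 : ℝ) ^ (-Δ) * hrBlock Δ ℓ (zOfRho (s ^ 2)) (zOfRho (u ^ 2))) :=
  hasSum_evenRadArr_of_hasSum hα c hc (hasSL2Reduction_of_redArr hΔ hα c hc hred) hs0 hs1 hu0 hu1

/-! ### §4. Identification with the conversion array `zRhoConv` -/

/-- The Hogervorst–Rychkov `z`-array of the even-sector block in the indexing of `RadialConversion`:
`A(n,j) = A^{HR}_{n,j}(Δ,ℓ)/λ_ℓ`. [cite: HogervorstRychkov2013, §3 eq. (3.4)] -/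
noncomputable def hrRadA (Δ : ℝ) (ℓ : ℕ) (q : ℕ × ℕ) : ℝ :=
  hrCoeff Δ ℓ q.1 q.2 / legendreLam ℓ

/-- `A ≥ 0` above the unitarity bound. [cite: HogervorstRychkov2013, §3 after eq. (3.9)] -/
theorem hrRadA_nonneg {Δ : ℝ} {ℓ : ℕ} (hΔ : unitarityBound3D ℓ < Δ) (q : ℕ × ℕ) : 0 ≤ hrRadA Δ ℓ q :=
  div_nonneg (hrCoeff_nonneg hΔ q.1 q.2) (legendreLam_pos ℓ).le

/-- `A(n,j) = 0` for `j > ℓ + n`. [cite: HogervorstRychkov2013, §3 eq. (3.4)] -/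
theorem hrRadA_support (Δ : ℝ) (ℓ : ℕ) : RadialSupport ℓ (hrRadA Δ ℓ) := fun q hq => by
  unfold hrRadA
  rw [hrCoeff_eq_zero_of_lt Δ hq, zero_div]

/-- The `z`-series of `hrBlock` in this indexing. [cite: HogervorstRychkov2013, §3 eqs. (3.4), (3.9)] -/
theorem hasSum_hrRadA_zMono {Δ : ℝ} {ℓ : ℕ} (hΔ : unitarityBound3D ℓ < Δ) (x y : ℝ)
    (hx : x ∈ Ioo (0 : ℝ) 1) (hy : y ∈ Ioo (0 : ℝ) 1) :
    HasSum (fun q : ℕ × ℕ => hrRadA Δ ℓ q * zMono (Δ + (q.1 : ℝ)) q.2 x y) (hrBlock Δ ℓ x y) :=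
  (hasSum_hrZTerm_hrBlock hΔ hx hy).congr_fun fun _ => rfl

/-- The `z`-side data of `RadialConversion`/`RadialExistenceOfPositivity` for the even-sector block, as a
HYPOTHESIS on `(Δ, ℓ)`: `A = A^{HR}/λ_ℓ ≥ 0` and the `z`-series sums to `hrBlock Δ ℓ` on the square.
Discharged strictly above the bound (`hasZData_of_lt`) and at the bound (`DimensionalReductionBound`).
[cite: HogervorstRychkov2013, §3 eqs. (3.4), (3.9)] -/
def HasZData (Δ : ℝ) (ℓ : ℕ) : Prop :=
  (∀ q, 0 ≤ hrRadA Δ ℓ q) ∧ (ℓ : ℝ) ≤ Δ ∧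
    ∀ x y : ℝ, x ∈ Ioo (0 : ℝ) 1 → y ∈ Ioo (0 : ℝ) 1 →
      HasSum (fun q : ℕ × ℕ => hrRadA Δ ℓ q * zMono (Δ + (q.1 : ℝ)) q.2 x y) (hrBlock Δ ℓ x y)

/-- Strictly above the unitarity bound the `z`-side data hold. [cite: HogervorstRychkov2013, §3 eqs. (3.4), (3.9)] -/
theorem hasZData_of_lt {Δ : ℝ} {ℓ : ℕ} (hΔ : unitarityBound3D ℓ < Δ) : HasZData Δ ℓ :=
  ⟨hrRadA_nonneg hΔ, natCast_le_of_unitarityBound3D_lt hΔ, fun x y hx hy => hasSum_hrRadA_zMono hΔ x y hx hy⟩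

/-- The array from the reduction formula is the conversion array, from the two hypotheses.
[cite: HogervorstRychkov2013, §3 "first method"] -/
theorem evenRadArr_eq_zRhoConv_of_hasSum {Δ : ℝ} {ℓ : ℕ} (hα : 1 / 4 < halfTwist Δ ℓ)
    (c : ℕ → ℕ → ℝ) (hc : ∀ a b, 0 ≤ c a b) (hredf : HasSL2Reduction Δ ℓ c) (hZ : HasZData Δ ℓ) :
    evenRadArr Δ ℓ c = zRhoConv 0 Δ ℓ (hrRadA Δ ℓ) := by
  obtain ⟨hA0, hℓΔ, hzA⟩ := hZ
  have hL : (fun p : ℕ × ℕ => evenRadArr Δ ℓ c p - zRhoConv 0 Δ ℓ (hrRadA Δ ℓ) p) = 0 := by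
    refine eq_zero_of_double_tsum_eq_zero_of_pos _ sqrt_two_sub_one_pos ?_
    intro s u hs0 hs1 hu0 hu1
    have h1 := hasSum_evenRadArr_of_hasSum hα c hc hredf hs0 hs1 hu0 hu1
    have h2 := hasSum_zRhoConv (c := 0) hA0 (hrRadA_support Δ ℓ) hℓΔ hzA hs0 hs1 hu0 hu1
    simp only [Real.rpow_zero, one_mul] at h2
    have h3 := h1.sub h2
    rw [sub_self] at h3
    have h4 : HasSum (fun q : ℕ × ℕ => (evenRadArr Δ ℓ c q - zRhoConv 0 Δ ℓ (hrRadA Δ ℓ) q) *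
        s ^ q.1 * u ^ q.2) 0 :=
      h3.congr_fun fun q => by ring
    exact ⟨h4.summable, h4.tsum_eq⟩
  funext p
  have := congr_fun hL p
  simpa [sub_eq_zero] using this

/-- **The array from the reduction formula IS the conversion array**: `evenRadArr Δ ℓ c = zRhoConv 0 Δ ℓ A`
(both are coefficient arrays of double power series with the same sum on `(0, √2-1)²`).
[cite: HogervorstRychkov2013, §3 "first method"] -/
theorem evenRadArr_eq_zRhoConv {Δ : ℝ} {ℓ : ℕ} (hΔ : unitarityBound3D ℓ < Δ) (hα : 1 / 4 < halfTwist Δ ℓ)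
    (c : ℕ → ℕ → ℝ) (hc : ∀ a b, 0 ≤ c a b) (hred : hrMonomialCoeff Δ ℓ = redArr Δ ℓ c) :
    evenRadArr Δ ℓ c = zRhoConv 0 Δ ℓ (hrRadA Δ ℓ) :=
  evenRadArr_eq_zRhoConv_of_hasSum hα c hc (hasSL2Reduction_of_redArr hΔ hα c hc hred) (hasZData_of_lt hΔ)

/-! ### §5. Positivity and unconditional convergence on the whole square -/

/-- The radial monomial array is non-negative, from the two hypotheses. [cite: HogervorstRychkov2013, §3.1] -/
theorem zRhoConv_nonneg_of_hasSum {Δ : ℝ} {ℓ : ℕ} (hα : 1 / 4 < halfTwist Δ ℓ)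
    (c : ℕ → ℕ → ℝ) (hc : ∀ a b, 0 ≤ c a b) (hredf : HasSL2Reduction Δ ℓ c) (hZ : HasZData Δ ℓ)
    (p : ℕ × ℕ) : 0 ≤ zRhoConv 0 Δ ℓ (hrRadA Δ ℓ) p := by
  rw [← evenRadArr_eq_zRhoConv_of_hasSum hα c hc hredf hZ]
  exact evenRadArr_nonneg (by linarith) hc p

/-- Unconditional radial convergence on the whole square, from the two hypotheses.
[cite: HogervorstRychkov2013, §3.1] -/
theorem hasSum_zRhoConv_hrBlock_of_hasSum {Δ : ℝ} {ℓ : ℕ} (hα : 1 / 4 < halfTwist Δ ℓ)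
    (c : ℕ → ℕ → ℝ) (hc : ∀ a b, 0 ≤ c a b) (hredf : HasSL2Reduction Δ ℓ c) (hZ : HasZData Δ ℓ)
    {s u : ℝ} (hs0 : 0 < s) (hs1 : s < 1) (hu0 : 0 < u) (hu1 : u < 1) :
    HasSum (fun p : ℕ × ℕ => zRhoConv 0 Δ ℓ (hrRadA Δ ℓ) p * (s ^ p.1 * u ^ p.2))
      ((s * u) ^ (-(Δ - (ℓ : ℝ))) * (4 : ℝ) ^ (-Δ) * hrBlock Δ ℓ (zOfRho (s ^ 2)) (zOfRho (u ^ 2))) := by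
  obtain ⟨hA0, hℓΔ, hzA⟩ := hZ
  have h := hasSum_zRhoConv_of_nonneg (c := 0) hA0 (hrRadA_support Δ ℓ) hℓΔ hzA
    (zRhoConv_nonneg_of_hasSum hα c hc hredf ⟨hA0, hℓΔ, hzA⟩) hs0 hs1 hu0 hu1
  simpa only [Real.rpow_zero, one_mul] using h

/-- **The radial monomial array of an even-sector block is non-negative** (generic site function).
[cite: Hogervorst2016, §2.2] [cite: HogervorstRychkov2013, §3.1] -/
theorem zRhoConv_nonneg_of_redArr {Δ : ℝ} {ℓ : ℕ} (hΔ : unitarityBound3D ℓ < Δ) (hα : 1 / 4 < halfTwist Δ ℓ)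
    (c : ℕ → ℕ → ℝ) (hc : ∀ a b, 0 ≤ c a b) (hred : hrMonomialCoeff Δ ℓ = redArr Δ ℓ c) (p : ℕ × ℕ) :
    0 ≤ zRhoConv 0 Δ ℓ (hrRadA Δ ℓ) p :=
  zRhoConv_nonneg_of_hasSum hα c hc (hasSL2Reduction_of_redArr hΔ hα c hc hred) (hasZData_of_lt hΔ) p

/-- **Unconditional radial convergence for even-sector blocks** (generic site function): for ALL
`0 < s, u < 1`, `Σ_p zRhoConv(p) s^{p₁} u^{p₂} = (su)^{-(Δ-ℓ)} 4^{-Δ} g_{Δ,ℓ}(z(s²), z(u²))` —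
Hogervorst–Rychkov §3.1 "all terms in the series are positive, and so the series must converge" with
positivity now PROVED. [cite: HogervorstRychkov2013, §3.1] [cite: Hogervorst2016, §2 eqs. (2.24), (2.35)] -/
theorem hasSum_zRhoConv_hrBlock {Δ : ℝ} {ℓ : ℕ} (hΔ : unitarityBound3D ℓ < Δ) (hα : 1 / 4 < halfTwist Δ ℓ)
    (c : ℕ → ℕ → ℝ) (hc : ∀ a b, 0 ≤ c a b) (hred : hrMonomialCoeff Δ ℓ = redArr Δ ℓ c)
    {s u : ℝ} (hs0 : 0 < s) (hs1 : s < 1) (hu0 : 0 < u) (hu1 : u < 1) :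
    HasSum (fun p : ℕ × ℕ => zRhoConv 0 Δ ℓ (hrRadA Δ ℓ) p * (s ^ p.1 * u ^ p.2))
      ((s * u) ^ (-(Δ - (ℓ : ℝ))) * (4 : ℝ) ^ (-Δ) * hrBlock Δ ℓ (zOfRho (s ^ 2)) (zOfRho (u ^ 2))) :=
  hasSum_zRhoConv_hrBlock_of_hasSum hα c hc (hasSL2Reduction_of_redArr hΔ hα c hc hred) (hasZData_of_lt hΔ)
    hs0 hs1 hu0 hu1

/-! ### §6. The two even-sector families: scalars, and spin `ℓ ≥ 1` -/

/-- `halfTwist Δ 0 = Δ/2 > ¼` for `Δ > ½`. [folklore] -/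
theorem halfTwist_scalar_gt {Δ : ℝ} (hΔ : 1 / 2 < Δ) : 1 / 4 < halfTwist Δ 0 := by
  unfold halfTwist; push_cast; linarith

/-- `halfTwist Δ ℓ > ½ > ¼` for `Δ > ℓ + 1`. [folklore] -/
theorem halfTwist_spin_gt {Δ : ℝ} {ℓ : ℕ} (hΔ : (ℓ : ℝ) + 1 < Δ) : 1 / 4 < halfTwist Δ ℓ := by
  unfold halfTwist; linarith

/-- The bound for scalars: `unitarityBound3D 0 = ½ < Δ`. [folklore] -/
theorem unitarityBound3D_scalar_lt {Δ : ℝ} (hΔ : 1 / 2 < Δ) : unitarityBound3D 0 < Δ := by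
  unfold unitarityBound3D; norm_num; linarith

/-- The bound for spin `ℓ ≥ 1`: `unitarityBound3D ℓ = ℓ + 1 < Δ`. [folklore] -/
theorem unitarityBound3D_spin_lt {Δ : ℝ} {ℓ : ℕ} (hℓ : 1 ≤ ℓ) (hΔ : (ℓ : ℝ) + 1 < Δ) :
    unitarityBound3D ℓ < Δ := by
  unfold unitarityBound3D; rw [if_neg (by omega)]; exact hΔ

/-- The scalar site function is non-negative (`Δ > ½`). [cite: Hogervorst2016, §2 eqs. (2.24), (2.35)] -/
theorem scalarSite_nonneg {Δ : ℝ} (hΔ : 1 / 2 < Δ) : ∀ a b : ℕ, 0 ≤ scalarSite Δ a b := fun a b => by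
  unfold scalarSite
  split_ifs
  · exact (scalarRedCoeff_pos hΔ _).le
  · exact le_rfl

/-- **Scalar blocks (`ℓ = 0`, every `Δ > ½`): the radial monomial array is non-negative.**
[cite: HogervorstRychkov2013, §3.1] [cite: Hogervorst2016, §2 eqs. (2.24), (2.35)] -/
theorem zRhoConv_nonneg_scalar {Δ : ℝ} (hΔ : 1 / 2 < Δ) (p : ℕ × ℕ) : 0 ≤ zRhoConv 0 Δ 0 (hrRadA Δ 0) p :=
  zRhoConv_nonneg_of_redArr (unitarityBound3D_scalar_lt hΔ) (halfTwist_scalar_gt hΔ) (scalarSite Δ)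
    (scalarSite_nonneg hΔ) (hrMonomialCoeff_eq_scalar_redArr hΔ) p

/-- **Scalar blocks (`ℓ = 0`, every `Δ > ½`): unconditional radial convergence on the whole square**:
`Σ_p zRhoConv(p) s^{p₁} u^{p₂} = (su)^{-Δ} 4^{-Δ} g_{Δ,0}(z(s²),z(u²))` for all `0 < s,u < 1`.
[cite: HogervorstRychkov2013, §3.1] [cite: Hogervorst2016, §2 eqs. (2.24), (2.35)] -/
theorem hasSum_zRhoConv_hrBlock_scalar {Δ : ℝ} (hΔ : 1 / 2 < Δ) {s u : ℝ} (hs0 : 0 < s) (hs1 : s < 1)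
    (hu0 : 0 < u) (hu1 : u < 1) :
    HasSum (fun p : ℕ × ℕ => zRhoConv 0 Δ 0 (hrRadA Δ 0) p * (s ^ p.1 * u ^ p.2))
      ((s * u) ^ (-(Δ - ((0 : ℕ) : ℝ))) * (4 : ℝ) ^ (-Δ) * hrBlock Δ 0 (zOfRho (s ^ 2)) (zOfRho (u ^ 2))) :=
  hasSum_zRhoConv_hrBlock (unitarityBound3D_scalar_lt hΔ) (halfTwist_scalar_gt hΔ) (scalarSite Δ)
    (scalarSite_nonneg hΔ) (hrMonomialCoeff_eq_scalar_redArr hΔ) hs0 hs1 hu0 hu1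

/-- **Spinning blocks (`ℓ ≥ 1`, `Δ > ℓ + 1`, off the accidental set): the radial monomial array is
non-negative.** [cite: HogervorstRychkov2013, §3.1] [cite: Hogervorst2016, §2 eqs. (2.24), (2.35)] -/
theorem zRhoConv_nonneg_spin {Δ : ℝ} {ℓ : ℕ} (hℓ : 1 ≤ ℓ) (hΔ : (ℓ : ℝ) + 1 < Δ)
    (hreg : ¬ accidentalDegeneracy3D Δ ℓ) (p : ℕ × ℕ) : 0 ≤ zRhoConv 0 Δ ℓ (hrRadA Δ ℓ) p :=
  zRhoConv_nonneg_of_redArr (unitarityBound3D_spin_lt hℓ hΔ) (halfTwist_spin_gt hΔ) (spinSite Δ ℓ)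
    (spinSite_nonneg hΔ) (hrMonomialCoeff_eq_spin_redArr hℓ hΔ hreg) p

/-- **Spinning blocks (`ℓ ≥ 1`, `Δ > ℓ + 1`, off the accidental set): unconditional radial convergence on
the whole square.** [cite: HogervorstRychkov2013, §3.1] [cite: Hogervorst2016, §2 eqs. (2.24), (2.35)] -/
theorem hasSum_zRhoConv_hrBlock_spin {Δ : ℝ} {ℓ : ℕ} (hℓ : 1 ≤ ℓ) (hΔ : (ℓ : ℝ) + 1 < Δ)
    (hreg : ¬ accidentalDegeneracy3D Δ ℓ) {s u : ℝ} (hs0 : 0 < s) (hs1 : s < 1) (hu0 : 0 < u)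
    (hu1 : u < 1) :
    HasSum (fun p : ℕ × ℕ => zRhoConv 0 Δ ℓ (hrRadA Δ ℓ) p * (s ^ p.1 * u ^ p.2))
      ((s * u) ^ (-(Δ - (ℓ : ℝ))) * (4 : ℝ) ^ (-Δ) * hrBlock Δ ℓ (zOfRho (s ^ 2)) (zOfRho (u ^ 2))) :=
  hasSum_zRhoConv_hrBlock (unitarityBound3D_spin_lt hℓ hΔ) (halfTwist_spin_gt hΔ) (spinSite Δ ℓ)
    (spinSite_nonneg hΔ) (hrMonomialCoeff_eq_spin_redArr hℓ hΔ hreg) hs0 hs1 hu0 hu1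

/-- **Typed form.** For a genuine even-sector block `g` (`IsConformalBlock3D 0 0 Δ ℓ g`, clause A2 of
`SigmaEpsilonSystem`) with `ℓ ≥ 1`, `Δ > ℓ + 1` off the accidental set: at every point of the open unit
`ρ`-square, `(ρρ̄)^{-(Δ-ℓ)/2} 4^{-Δ} g(z(ρ), z(ρ̄)) = Σ_p zRhoConv(p) (√ρ)^{p₁} (√ρ̄)^{p₂}` with
`zRhoConv ≥ 0` (`zRhoConv_nonneg_spin`) — written with `(s,u) = (√ρ,√ρ̄)`.
[cite: HogervorstRychkov2013, §3 after eq. (3.5) ("will converge for |ρ| < 1")] -/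
theorem IsConformalBlock3D.hasSum_zRhoConv_even {Δ : ℝ} {ℓ : ℕ} {g : ℝ → ℝ → ℝ} (hℓ : 1 ≤ ℓ)
    (hΔ : (ℓ : ℝ) + 1 < Δ) (hreg : ¬ accidentalDegeneracy3D Δ ℓ) (hg : IsConformalBlock3D 0 0 Δ ℓ g)
    {s u : ℝ} (hs0 : 0 < s) (hs1 : s < 1) (hu0 : 0 < u) (hu1 : u < 1) :
    HasSum (fun p : ℕ × ℕ => zRhoConv 0 Δ ℓ (hrRadA Δ ℓ) p * (s ^ p.1 * u ^ p.2))
      ((s * u) ^ (-(Δ - (ℓ : ℝ))) * (4 : ℝ) ^ (-Δ) * g (zOfRho (s ^ 2)) (zOfRho (u ^ 2))) := by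
  have hs2 : s ^ 2 < 1 := by nlinarith
  have hu2 : u ^ 2 < 1 := by nlinarith
  have hx : zOfRho (s ^ 2) ∈ Ioo (0 : ℝ) 1 :=
    ⟨zOfRho_pos (pow_pos hs0 2), zOfRho_lt_one (by nlinarith) hs2.ne⟩
  have hy : zOfRho (u ^ 2) ∈ Ioo (0 : ℝ) 1 :=
    ⟨zOfRho_pos (pow_pos hu0 2), zOfRho_lt_one (by nlinarith) hu2.ne⟩
  rw [hg.eq_hrBlock (unitarityBound3D_spin_lt hℓ hΔ) hreg _ _ hx hy]
  exact hasSum_zRhoConv_hrBlock_spin hℓ hΔ hreg hs0 hs1 hu0 hu1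

/-- **Typed form, scalars.** For a genuine scalar block `g` (`IsConformalBlock3D 0 0 Δ 0 g`, `Δ > ½`):
the same unconditional expansion with `zRhoConv ≥ 0` (`zRhoConv_nonneg_scalar`).
[cite: HogervorstRychkov2013, §3 after eq. (3.5)] -/
theorem IsConformalBlock3D.hasSum_zRhoConv_scalar {Δ : ℝ} {g : ℝ → ℝ → ℝ} (hΔ : 1 / 2 < Δ)
    (hg : IsConformalBlock3D 0 0 Δ 0 g) {s u : ℝ} (hs0 : 0 < s) (hs1 : s < 1) (hu0 : 0 < u) (hu1 : u < 1) :
    HasSum (fun p : ℕ × ℕ => zRhoConv 0 Δ 0 (hrRadA Δ 0) p * (s ^ p.1 * u ^ p.2))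
      ((s * u) ^ (-(Δ - ((0 : ℕ) : ℝ))) * (4 : ℝ) ^ (-Δ) * g (zOfRho (s ^ 2)) (zOfRho (u ^ 2))) := by
  have hs2 : s ^ 2 < 1 := by nlinarith
  have hu2 : u ^ 2 < 1 := by nlinarith
  have hx : zOfRho (s ^ 2) ∈ Ioo (0 : ℝ) 1 :=
    ⟨zOfRho_pos (pow_pos hs0 2), zOfRho_lt_one (by nlinarith) hs2.ne⟩
  have hy : zOfRho (u ^ 2) ∈ Ioo (0 : ℝ) 1 :=
    ⟨zOfRho_pos (pow_pos hu0 2), zOfRho_lt_one (by nlinarith) hu2.ne⟩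
  rw [hg.eq_hrBlock (unitarityBound3D_scalar_lt hΔ) (not_accidentalDegeneracy3D_scalar hΔ) _ _ hx hy]
  exact hasSum_zRhoConv_hrBlock_scalar hΔ hs0 hs1 hu0 hu1

end Literature.MathematicalPhysics.QuantumFieldTheory.ConformalBootstrap3D
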